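import Mathlib
import Literature.NumberTheory.LFunctions.Zhang2022.Section12Eq1212Profiles
import Literature.NumberTheory.LFunctions.Zhang2022.Section9SharpApplications
import Literature.NumberTheory.LFunctions.Zhang2022.Section8FrontEnd810
import Literature.NumberTheory.LFunctions.Zhang2022.Section14Eq143TailBounds
import HarnessLib

/-!
# Zhang (2022) §12 (12.12) from Lemma 12.2: the leaf `Typed.Sec12C.Eq1212 c′` as an edge from the typed
# Lemma 12.2 (`Typed.Sec12B.Lemma122`, rate `O(𝓛⁻¹⁵)`) and Lemma 8.2

Topic `Literature/NumberTheory/LFunctions/Zhang2022` (Landau–Siegel audit tree; verdict-neutral).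
Y. Zhang, *Discrete mean estimates and the Landau–Siegel zero*, arXiv:2211.02515v1 (2022)
[Zhang2022LandauSiegel] — **an unrefereed manuscript under adjudication; this theorem-only file proves one
typed CLAIM node of its §12 from other typed nodes and asserts nothing about its Theorems 1–2 or about
Landau–Siegel zeros** (lane ZHANG-L, WP12, seat zl-w12-p10; leaf `h1212` of
`Skeleton.theorem1_of_leaves_v19`).

The node [Z22 p.71, (12.12), tex L3605–L3612]: "By Lemma 8.2, 8.3 and 12.2, the sum over `dr ≤ P″₁/T` is
equal to `L′(1,χ)²b*β_{j+1}β_{j+2}Σ_{n<P^{0.496}}|χ(n)|λ₀ⱼ(n)φ(n)⁻¹(ῑ₃𝓕_{j6}(P^{0.498}/n)/0.498 +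
ῑ₄𝓕_{j7}(P^{0.5}/n)/0.5) + o(α) = 𝔞b*(log P)β_{j+1}β_{j+2}∫₀^{0.496}(…)dz + o(α)`" — typed by L3-t9 as
`Typed.Sec12C.Eq1212 c′`. PROVED HERE as the edges

* `eq1212_first_of_lemma122 : Lemma82 c′ → Sec12B.Lemma122 c′ (𝓛⁻¹⁵) → (first equality)`,
* `eq1212_of_lemma122 : Lemma82 c′ → Sec12B.Lemma122 c′ (𝓛⁻¹⁵) → Eq1212 c′` (with the landed second
  equality `eq1212_sum_sub_int`, `Section12Eq1212Integral`), and
* `eq1212_of_lemma122' : 0 ≤ c′ → Sec12B.Lemma122 c′ (𝓛⁻¹⁵) → Eq1212 c′` (Lemma 8.2 is a tree theorem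
  for `c′ ≥ 0`, `Skeleton.lemma82_holds`).

Here `Sec12B.Lemma122 c′ E = Eq1210 c′ E ∧ Eq1211 c′` is the manuscript's Lemma 12.2 as typed
(`TypedSection12B`): (12.10) with the rate `E = 𝓛⁻¹⁵` its printed proof supports (the error term of
(12.10) is BLANK in print, GAP row G-L3t5-1; kernel edge `Sec12B.eq1210L15_of_u024_u025`), and (12.11)
(no printed proof, GAP row G-L3t5-2). (12.11) is used ONLY at the single boundary point `dr = P″₁/T`
(the leaf's range is `dr ≤ P″₁/T`, Lemma 12.2's (12.10) is stated for `dr < P″₁/T`).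

## The argument (the printed "By Lemma 8.2, 8.3 and 12.2", made quantitative)

After `n = dr` (`SjOn_a12_a25_eq_divisor_sum`) the `(d,r)`-term is `[r sqfree]a(n)φ(r)⁻¹·M(n)·N(d,r)` with
`a(n) = |χ(n)|λ₀ⱼ(n)/n`, `M(n) = ῑ₃Σ_mχ(m)ϰ₃(nm)m^{β_j−1} + ῑ₄Σ_mχ(m)ϰ₂(nm)m^{β_j−1}` and
`N(d,r) = Σ_lχ(l)ϰ̄₁₃(drl)ξ₀ⱼ(l;d,r)/l` (`Sec12B.sum122`).
* Lemma 8.2 at `x = P₃/n` (`μ = 6`) and `x = P₂/n` (`μ = 7`) (tree: `Section9Discharge.step9u002_sharp`,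
  `step8u041_of_lemma82`, rate `𝓛⁻¹⁵`, valid for `n ≤ P″₁/T < P₃/T`) and the comparison of Lemma 8.2's
  profile with the PRINTED one (`norm_F_sub_Fpr_le`: `P₃ = P^{0.498}` exactly, `P₂ = P^{0.5}T^{−10}` costs
  `O(𝓛^{1.1}𝓛⁻¹⁸)`) give `M(n) = L′(1,χ)F_pr(n)/log P + O(𝓛⁻¹⁴)`, `|L′F_pr/log P| ≪ 𝓛⁻⁷`;
* (12.10): `N(d,r) = b*L′(1,χ)Π(d,r)(log P)β_{j+1}β_{j+2} + O(𝓛⁻¹⁵)` for `dr < P″₁/T`; at `dr = P″₁/T`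
  (if an integer) (12.11) gives `|N| ≪ α𝓛`;
* the abstract range assembly `Skeleton.range_assembly_bound₂` (with (8.10), `Section8FrontEnd810.eq810_holds`)
  collapses `Σ_{r∣n sqfree}Π(n/r,r)/φ(r) = n/φ(n)` and bounds the difference to the collapsed main term by
  `W₁·O(𝓛⁻²¹) + W₂·O(𝓛⁻¹⁴)` with the weights `W₁ = Σ_{n≤P″₁/T}(n/φ(n))⁷/n ≪ 𝓛⁹`, `W₂ ≪ 1`
  (`Skeleton.sum_ratio_pow_div_le`);
* the collapsed main term is the printed one restricted to `n ≤ P″₁/T`; the printed window reaches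
  `P^{0.496} = (T/Dt₀)·P″₁/T`, and the extra piece weighs `|L′²b*β_{j+1}β_{j+2}|·29K_ι·e²⁵⁶(3 + log T) ≪ 𝓛⁻¹²`.
Altogether `‖S_j|_{dr≤P″₁/T} − main1212sum‖ ≤ K𝓛⁻¹² ≤ εα` once `𝓛 ≥ K/(επ) + 1` (and `𝓛 ≥ 5`,
`5|c′|α𝓛 ≤ 1`, `4Dt₀² ≤ T`, the latter from the tree's `Eq143Tail.four_D_t0_sq_le_bigT`).
No new definitions, no named facts; standard axioms.

## References

* Y. Zhang, arXiv:2211.02515v1 (2022), §12 (12.12) p.71 (tex L3600–L3612), Lemma 12.2 p.69;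
  §8 Lemma 8.2, (8.6), (8.10) pp.45–48; §7 Prop. 7.1 p.33; §2 (2.6), (2.13), (2.21), (2.26), (2.31).
  [cite: Zhang2022LandauSiegel, §12 (12.12) p.71]
* R. R. Hall, G. Tenenbaum, *Divisors*, CUP 1988, §0.2. [cite: HallTenenbaum1988, §0.2]
-/

noncomputable section

open Complex Real ComplexConjugate
open Literature.NumberTheory.LFunctions.Zhang2022.Skeleton

namespace Literature.NumberTheory.LFunctions.Zhang2022.Typed.Sec12C

open Literature.NumberTheory.LFunctions.Zhang2022.Typed.Sec10C.Ranges1422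

/-! ## Scales: `Y = P″₁/T`, `X = P^{0.496}` -/

section Scales

variable {D : ℕ}

/-- `520L + 10L² ≤ 0.002L⁹` for `L ≥ 5`. [cite: Zhang2022LandauSiegel, §2 (2.6), (2.21)] -/
theorem poly_aux12 {L : ℝ} (hL : 5 ≤ L) : 520 * L + 10 * L ^ 2 + 2 ≤ 0.002 * L ^ 9 := by
  have hL0 : 0 ≤ L := by linarith
  have h7 : (78125 : ℝ) ≤ L ^ 7 := le_trans (by norm_num) (pow_le_pow_left₀ (by norm_num) hL 7)
  have h9 : 78125 * L ^ 2 ≤ L ^ 9 := by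
    rw [show L ^ 9 = L ^ 7 * L ^ 2 by ring]
    exact mul_le_mul_of_nonneg_right h7 (by positivity)
  nlinarith

/-- **The scales of (12.12)** for `𝓛 ≥ 5` and `4Dt₀² ≤ T`: with `Y = P″₁/T`, `X = P^{0.496}`:
`2 ≤ Y ≤ P″₁ ≤ P`, `P″₁ < P₃`, `P″₁ < P₂`, `4Y ≤ X ≤ P₂ ≤ PT⁻²`.
[cite: Zhang2022LandauSiegel, §2 (2.6), (2.21); §12 p.67] -/
theorem scales12 (hℓ5 : 5 ≤ ell D) (hT4 : 4 * (D : ℝ) * t0 D ^ 2 ≤ bigT D) :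
    2 ≤ P1pp D / bigT D ∧ P1pp D / bigT D ≤ P1pp D ∧ P1pp D ≤ bigP D ∧
      P1pp D < Skeleton.P3 D ∧ P1pp D < Skeleton.P2 D ∧
      4 * (P1pp D / bigT D) ≤ bigP D ^ (0.496 : ℝ) ∧ bigP D ^ (0.496 : ℝ) ≤ Skeleton.P2 D ∧
      Skeleton.P2 D ≤ bigP D / bigT D ^ 2 := by
  have hℓ : 3 ≤ ell D := by linarith
  have h1 : 1 ≤ ell D := by linarith
  have h0 : 0 < ell D := by linarith
  have h11 : ell D ^ (1.1 : ℝ) ≤ ell D ^ 2 := by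
    have h : ell D ^ (1.1 : ℝ) ≤ ell D ^ (2 : ℝ) :=
      Real.rpow_le_rpow_of_exponent_le h1 (by norm_num)
    simpa using h
  have h11pos : 0 ≤ ell D ^ (1.1 : ℝ) := Real.rpow_nonneg h0.le _
  have hDt1 := Dt0_ge_one (D := D) hℓ
  have hDt0 := Dt0_pos (D := D) hℓ
  have hDt : (D : ℝ) * t0 D ≤ Real.exp (520 * ell D) := by
    have h := Real.exp_le_exp.mpr (log_Dt0_le (D := D) hℓ)
    rwa [Real.exp_log hDt0] at h
  have hT : bigT D = Real.exp (ell D ^ (1.1 : ℝ)) := rfl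
  have hT0 : 0 < bigT D := Real.exp_pos _
  have hT1 : 1 ≤ bigT D := by rw [hT]; exact Real.one_le_exp h11pos
  have hP1pp : P1pp D = Real.exp (0.496 * ell D ^ 9) * ((D : ℝ) * t0 D) := by
    rw [P1pp, bigP, ← Real.exp_mul]; ring
  have hP1pp_le : P1pp D ≤ Real.exp (0.496 * ell D ^ 9 + 520 * ell D) := by
    rw [Real.exp_add, hP1pp]
    exact mul_le_mul_of_nonneg_left hDt (by positivity)
  have hpoly := poly_aux12 hℓ5
  have hP3 : Skeleton.P3 D = Real.exp (0.498 * ell D ^ 9) := by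
    rw [Skeleton.P3, bigP, ← Real.exp_mul]; ring_nf
  have hP2 : Skeleton.P2 D = Real.exp (0.5 * ell D ^ 9 - 10 * ell D ^ (1.1 : ℝ)) := by
    rw [Skeleton.P2, bigP, bigT, ← Real.exp_mul, ← Real.exp_nat_mul, ← Real.exp_sub]; ring_nf
  have hX : bigP D ^ (0.496 : ℝ) = Real.exp (0.496 * ell D ^ 9) := by
    rw [bigP, ← Real.exp_mul]; ring_nf
  refine ⟨?_, div_le_self (le_of_lt (Sec12D.P1pp_pos (by simpa only [ell] using h1))) hT1, ?_, ?_, ?_,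
    ?_, ?_, (Section9FrontEndExact.scales_ok (D := D) (by linarith)).1⟩
  · -- `2 ≤ Y`
    rw [le_div_iff₀ hT0, hT, hP1pp]
    have h2 : (2 : ℝ) ≤ Real.exp 1 := by
      have := Real.add_one_le_exp (1 : ℝ); linarith
    calc 2 * Real.exp (ell D ^ (1.1 : ℝ)) ≤ Real.exp 1 * Real.exp (ell D ^ (1.1 : ℝ)) := by
          gcongr
      _ = Real.exp (1 + ell D ^ (1.1 : ℝ)) := by rw [Real.exp_add]
      _ ≤ Real.exp (0.496 * ell D ^ 9) := by rw [Real.exp_le_exp]; nlinarith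
      _ = Real.exp (0.496 * ell D ^ 9) * 1 := (mul_one _).symm
      _ ≤ Real.exp (0.496 * ell D ^ 9) * ((D : ℝ) * t0 D) := by gcongr
  · -- `P″₁ ≤ P`
    refine hP1pp_le.trans ?_
    rw [bigP, Real.exp_le_exp]
    nlinarith
  · -- `P″₁ < P₃`
    refine hP1pp_le.trans_lt ?_
    rw [hP3, Real.exp_lt_exp]
    nlinarith
  · -- `P″₁ < P₂`
    refine hP1pp_le.trans_lt ?_
    rw [hP2, Real.exp_lt_exp]
    nlinarith
  · -- `4Y ≤ X`: `4Dt₀ ≤ 4Dt₀² ≤ T`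
    have h4 : 4 * ((D : ℝ) * t0 D) ≤ bigT D := by
      have ht1 := t0_ge_one (D := D) hℓ
      calc 4 * ((D : ℝ) * t0 D) = 4 * (D : ℝ) * t0 D * 1 := by ring
        _ ≤ 4 * (D : ℝ) * t0 D * t0 D := by
            apply mul_le_mul_of_nonneg_left ht1; positivity
        _ = 4 * (D : ℝ) * t0 D ^ 2 := by ring
        _ ≤ bigT D := hT4
    rw [hP1pp, hX]
    rw [show 4 * (Real.exp (0.496 * ell D ^ 9) * ((D : ℝ) * t0 D) / bigT D) =
        Real.exp (0.496 * ell D ^ 9) * (4 * ((D : ℝ) * t0 D) / bigT D) by ring]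
    have : 4 * ((D : ℝ) * t0 D) / bigT D ≤ 1 := by rw [div_le_one hT0]; exact h4
    calc Real.exp (0.496 * ell D ^ 9) * (4 * ((D : ℝ) * t0 D) / bigT D)
        ≤ Real.exp (0.496 * ell D ^ 9) * 1 := by gcongr
      _ = Real.exp (0.496 * ell D ^ 9) := mul_one _
  · -- `X ≤ P₂`
    rw [hX, hP2, Real.exp_le_exp]
    nlinarith

end Scales

/-! ## The core estimate at a fixed modulus -/

section Core

variable (c' : ℝ)

set_option maxHeartbeats 1600000 in
/-- **(12.12), first equality, at a fixed modulus.** For every `c′` and constants `C₉, C₁₀, C₁₁ ≥ 0` there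
is `K` such that: if `D` (with `𝓛 ≥ 5`, `5|c′|α𝓛 ≤ 1`, `4Dt₀² ≤ T`), a real primitive `χ (mod D)` and
`j` satisfy Lemma 8.2's two evaluations (`μ = 6` at `P₃/dr`, `μ = 7` at `P₂/dr`) with rate `C₉𝓛⁻¹⁵`,
(12.10) with rate `C₁₀𝓛⁻¹⁵` on `dr < P″₁/T` and (12.11) with constant `C₁₁` on `P″₁/T ≤ dr ≤ P″₁`, then for
`𝐚₂₅ = conj(χϰ₁₃)`: `‖S_j(𝐚₁₂,𝐚₂₅)|_{dr≤P″₁/T} − main1212sum‖ ≤ K𝓛⁻¹²`.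
[cite: Zhang2022LandauSiegel, §12 (12.12) p.71, tex L3605–L3612] -/
theorem eq1212_first_core {C₉ C₁₀ C₁₁ : ℝ} (hC₉ : 0 ≤ C₉) (hC₁₀ : 0 ≤ C₁₀) (hC₁₁ : 0 ≤ C₁₁) :
    ∃ K : ℝ, 0 ≤ K ∧ ∀ {D : ℕ} [NeZero D] {χ : DirichletCharacter ℂ D}, χ.IsQuadratic →
      χ.IsPrimitive → 5 ≤ ell D → 5 * |c'| * alpha D * ell D ≤ 1 → 4 * (D : ℝ) * t0 D ^ 2 ≤ bigT D →
      ∀ j : ℕ,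
      (∀ d r : ℕ, 1 ≤ d → 1 ≤ r → ((d * r : ℕ) : ℝ) < Skeleton.P3 D / bigT D →
        ‖(∑ m ∈ Finset.Ico 1 (Nsupp D),
              χ (m : ZMod D) * vk3 D (d * r * m) / (m : ℂ) ^ (1 - betaJ c' D j)) -
            deriv χ.LFunction 1 / (Real.log (Skeleton.P3 D) : ℂ) *
              frakfW c' D j 6 (Skeleton.P3 D / ((d * r : ℕ) : ℝ))‖ ≤ C₉ * (ell D ^ 15)⁻¹) →
      (∀ d r : ℕ, 1 ≤ d → 1 ≤ r → ((d * r : ℕ) : ℝ) < Skeleton.P2 D / bigT D →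
        ‖(∑ m ∈ Finset.Ico 1 (Nsupp D),
              χ (m : ZMod D) * vk2 D (d * r * m) / (m : ℂ) ^ (1 - betaJ c' D j)) -
            deriv χ.LFunction 1 / (Real.log (Skeleton.P2 D) : ℂ) *
              frakfW c' D j 7 (Skeleton.P2 D / ((d * r : ℕ) : ℝ))‖ ≤ C₉ * (ell D ^ 15)⁻¹) →
      (∀ d r : ℕ, 1 ≤ d → 1 ≤ r → ((d * r : ℕ) : ℝ) < P1pp D / bigT D →
        ‖Sec12B.sum122 c' χ j d r - Sec12B.main1210 c' χ j d r‖ ≤ C₁₀ * (ell D ^ 15)⁻¹) →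
      (∀ d r : ℕ, 1 ≤ d → 1 ≤ r → P1pp D / bigT D ≤ ((d * r : ℕ) : ℝ) → ((d * r : ℕ) : ℝ) ≤ P1pp D →
        ‖Sec12B.sum122 c' χ j d r‖ ≤ C₁₁ * alpha D * ell D) →
      ∀ a25 : ℕ → ℂ, (∀ n, a25 n = conj (χ (n : ZMod D) * vk13 D n)) →
        ‖SjOn c' D j (a12 χ) a25 (rngLow D) - main1212sum c' χ j‖ ≤ K * (ell D ^ 12)⁻¹ := by
  classical
  -- the constants
  set fpr : ℝ := 29 * (1.25 / 0.498 + 2.3 / 0.5) with hfpr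
  set a₀ : ℝ := 4 * Real.exp (9 / 2) * fpr with ha₀
  set m₀ : ℝ := 3.55 * C₉ + 4 * Real.exp (9 / 2) * 25000 with hm₀
  set c₀₀ : ℝ := ‖bstar‖ * (4 * Real.exp (9 / 2)) * (9 * π * (1 + 5 * |c'| * π) ^ 2) * π with hc₀₀
  set k₀ : ℝ := 4 * Real.exp (9 / 2) * c₀₀ with hk₀
  set K : ℝ := 3 * Real.exp 256 * ((a₀ + m₀) * C₁₀ + m₀ * c₀₀) +
    3 * Real.exp 256 * ((a₀ + m₀) * (C₁₁ * π) + a₀ * c₀₀) + 4 * Real.exp 256 * k₀ * fpr with hK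
  have hfpr0 : 0 ≤ fpr := by rw [hfpr]; norm_num
  have ha₀0 : 0 ≤ a₀ := by rw [ha₀]; positivity
  have hm₀0 : 0 ≤ m₀ := by rw [hm₀]; positivity
  have hc₀₀0 : 0 ≤ c₀₀ := by rw [hc₀₀]; positivity
  have hk₀0 : 0 ≤ k₀ := by rw [hk₀]; positivity
  refine ⟨K, by rw [hK]; positivity, ?_⟩
  intro D _ χ hq hp hℓ5 hc5 hT4 j hM3 hM2 h10 h11 a25 ha25
  -- scales
  obtain ⟨hY2, hYP1pp, hP1ppP, hP1P3, hP1P2, h4YX, hXP2, hP2PT⟩ := scales12 hℓ5 hT4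
  set L : ℝ := ell D with hLdef
  set Y : ℝ := P1pp D / bigT D with hYdef
  set X : ℝ := bigP D ^ (0.496 : ℝ) with hXdef
  have hℓ3 : 3 ≤ ell D := by linarith
  have hL1 : 1 ≤ L := by rw [hLdef]; linarith
  have hL0 : 0 < L := by linarith
  have hD3 : 3 ≤ Real.log D := by simpa only [ell] using hℓ3
  have hD1 : 1 ≤ Real.log D := by linarith
  have hD4 : 4 ≤ Real.log D := by have : 4 ≤ ell D := by linarith
                                  simpa only [ell] using this
  obtain ⟨hα, hαeq, hαℓ⟩ := alpha_facts (D := D) hℓ3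
  have hlogP : Real.log (bigP D) = L ^ 9 := by rw [hLdef, log_bigP]
  have hlogP0 : 0 < Real.log (bigP D) := by rw [hlogP]; positivity
  have hT0 : 0 < bigT D := Real.exp_pos _
  have hY1 : 1 ≤ Y := by linarith
  have hY0 : 0 < Y := by linarith
  have hYX : Y ≤ X := by linarith
  have hYP3T : Y < Skeleton.P3 D / bigT D := div_lt_div_of_pos_right hP1P3 hT0
  have hYP2T : Y < Skeleton.P2 D / bigT D := div_lt_div_of_pos_right hP1P2 hT0
  have hP1 : 1 ≤ bigP D := Sec10C.one_le_bigP D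
  have hX498 : X ≤ bigP D ^ (0.498 : ℝ) := Real.rpow_le_rpow_of_exponent_le hP1 (by norm_num)
  have hX5 : X ≤ bigP D ^ (0.5 : ℝ) := Real.rpow_le_rpow_of_exponent_le hP1 (by norm_num)
  have hXPT : X ≤ bigP D / bigT D ^ 2 := hXP2.trans hP2PT
  have hceilX : ⌈X⌉₊ ≤ Nsupp D := Nat.ceil_mono hXPT
  -- sizes of `L′`, `c₀`, `K₁₂`
  have hL' : ‖deriv χ.LFunction 1‖ ≤ 4 * Real.exp (9 / 2) * L ^ 2 := norm_deriv_L_one_le χ hℓ3 hp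
  set c₀ : ℂ := bstar * deriv χ.LFunction 1 * (Real.log (bigP D) : ℂ) *
    betaJ c' D (j + 1) * betaJ c' D (j + 2) with hc₀def
  have hββ := Sec12D.norm_betaJ_mul_betaJ_mul_logP_le c' (D := D) hD1 (j + 1) (j + 2)
  have hc₀ : ‖c₀‖ ≤ c₀₀ * (L ^ 7)⁻¹ := by
    have e : ‖c₀‖ = ‖bstar‖ * ‖deriv χ.LFunction 1‖ *
        (‖betaJ c' D (j + 1) * betaJ c' D (j + 2)‖ * Real.log (bigP D)) := by
      rw [hc₀def, norm_mul, norm_mul, norm_mul, norm_mul, Complex.norm_real,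
        Real.norm_of_nonneg hlogP0.le, norm_mul]
      ring
    rw [e]
    calc ‖bstar‖ * ‖deriv χ.LFunction 1‖ * (‖betaJ c' D (j + 1) * betaJ c' D (j + 2)‖ * Real.log (bigP D))
        ≤ ‖bstar‖ * (4 * Real.exp (9 / 2) * L ^ 2) * (9 * π * (1 + 5 * |c'| * π) ^ 2 * alpha D) := by
          gcongr
      _ = c₀₀ * (L ^ 7)⁻¹ := by
          rw [hc₀₀, hαeq, ← hLdef]; field_simp
  -- the objects of the assembly
  set S : Finset ℕ := (Finset.Ico 1 (Nsupp D)).filter (fun n => rngLow D n) with hSdef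
  set a : ℕ → ℂ := fun n => (‖χ (n : ZMod D)‖ : ℂ) * lamZero c' D j n / (n : ℂ) with hadef
  set M₃ : ℕ → ℂ := fun n => ∑ m ∈ Finset.Ico 1 (Nsupp D),
    χ (m : ZMod D) * vk3 D (n * m) / (m : ℂ) ^ (1 - betaJ c' D j) with hM₃def
  set M₂ : ℕ → ℂ := fun n => ∑ m ∈ Finset.Ico 1 (Nsupp D),
    χ (m : ZMod D) * vk2 D (n * m) / (m : ℂ) ^ (1 - betaJ c' D j) with hM₂def
  set M : ℕ → ℂ := fun n => conj iota3 * M₃ n + conj iota4 * M₂ n with hMdef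
  set Fpr : ℕ → ℂ := fun n => conj iota3 * frakfW c' D j 6 (bigP D ^ (0.498 : ℝ) / n) / 0.498 +
    conj iota4 * frakfW c' D j 7 (bigP D ^ (0.5 : ℝ) / n) / 0.5 with hFprdef
  set A : ℕ → ℂ := fun n => deriv χ.LFunction 1 * Fpr n / (Real.log (bigP D) : ℂ) with hAdef
  set N : ℕ → ℕ → ℂ := fun d r => Sec12B.sum122 c' χ j d r with hNdef
  set Pw : ℕ → ℕ → ℂ := fun d r => PiW χ d r with hPwdef
  set G : ℕ → ℂ := fun _ => 1 with hGdef
  -- membership in `S`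
  have hSmem : ∀ n ∈ S, 1 ≤ n ∧ (n : ℝ) ≤ Y := by
    intro n hn
    rw [hSdef, Finset.mem_filter, Finset.mem_Ico] at hn
    exact ⟨hn.1.1, hn.2⟩
  have hS0 : ∀ n ∈ S, n ≠ 0 := fun n hn => by have := (hSmem n hn).1; omega
  have hRlt : ∀ n : ℕ, rngLow D n → n < Nsupp D := by
    intro n hn
    have h : (n : ℝ) < bigP D / bigT D ^ 2 := lt_of_le_of_lt hn (by linarith)
    exact Nat.lt_ceil.mpr h
  -- Step A: the re-indexed `S_j`
  have hSj : SjOn c' D j (a12 χ) a25 (rngLow D) =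
      ∑ n ∈ S, ∑ r ∈ n.divisors,
        (if Squarefree r then a n / (Nat.totient r : ℂ) * M n * N (n / r) r else 0) := by
    rw [SjOn_a12_a25_eq_divisor_sum c' χ hq hD3 j ha25 (rngLow D) hRlt]
    try rfl
  -- Step B: pointwise inputs of the assembly
  have hPi : ∀ n ∈ S, (n : ℝ) < Y →
      ∑ r ∈ n.divisors with Squarefree r, (1 / (Nat.totient r : ℂ)) * Pw (n / r) r =
        (n : ℂ) / (Nat.totient n : ℂ) :=
    fun n hn _ => Section8FrontEnd810.eq810_holds D χ hq n (hS0 n hn)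
  -- `M(n) = A(n) + O(𝓛⁻¹⁴)` for all `n ∈ S`
  have hMA : ∀ n ∈ S, ‖M n - A n‖ ≤ m₀ * (L ^ 14)⁻¹ := by
    intro n hn
    obtain ⟨hn1, hnY⟩ := hSmem n hn
    have hn1R : (1 : ℝ) ≤ n := by exact_mod_cast hn1
    have hnP3 : ((n * 1 : ℕ) : ℝ) < Skeleton.P3 D / bigT D := by
      rw [Nat.mul_one]; exact lt_of_le_of_lt hnY hYP3T
    have hnP2 : ((n * 1 : ℕ) : ℝ) < Skeleton.P2 D / bigT D := by
      rw [Nat.mul_one]; exact lt_of_le_of_lt hnY hYP2T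
    have e3 := hM3 n 1 hn1 le_rfl hnP3
    have e2 := hM2 n 1 hn1 le_rfl hnP2
    simp only [Nat.mul_one] at e3 e2
    have hbr := norm_F_sub_Fpr_le c' (D := D) hℓ3 hc5 j hn1R (hnY.trans (hYX.trans hX5))
    have hi3 : ‖conj iota3‖ ≤ 1.25 := by rw [Complex.norm_conj]; exact Sec10C.norm_iota34_le.1
    have hi4 : ‖conj iota4‖ ≤ 2.3 := by rw [Complex.norm_conj]; exact Sec10C.norm_iota34_le.2
    have hlogP_ne : (Real.log (bigP D) : ℂ) ≠ 0 := by exact_mod_cast hlogP0.ne'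
    have hid : M n - A n =
        conj iota3 * (M₃ n - deriv χ.LFunction 1 / (Real.log (Skeleton.P3 D) : ℂ) *
            frakfW c' D j 6 (Skeleton.P3 D / (n : ℝ))) +
          conj iota4 * (M₂ n - deriv χ.LFunction 1 / (Real.log (Skeleton.P2 D) : ℂ) *
            frakfW c' D j 7 (Skeleton.P2 D / (n : ℝ))) +
          deriv χ.LFunction 1 *
            ((conj iota3 * (Real.log (Skeleton.P3 D) : ℂ)⁻¹ * frakfW c' D j 6 (Skeleton.P3 D / n) +
                conj iota4 * (Real.log (Skeleton.P2 D) : ℂ)⁻¹ * frakfW c' D j 7 (Skeleton.P2 D / n)) -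
              (conj iota3 * frakfW c' D j 6 (bigP D ^ (0.498 : ℝ) / n) / 0.498 +
                conj iota4 * frakfW c' D j 7 (bigP D ^ (0.5 : ℝ) / n) / 0.5) /
                (Real.log (bigP D) : ℂ)) := by
      have eM : M n = conj iota3 * M₃ n + conj iota4 * M₂ n := rfl
      have eA : A n = deriv χ.LFunction 1 * Fpr n / (Real.log (bigP D) : ℂ) := rfl
      have eF : Fpr n = conj iota3 * frakfW c' D j 6 (bigP D ^ (0.498 : ℝ) / n) / 0.498 +
          conj iota4 * frakfW c' D j 7 (bigP D ^ (0.5 : ℝ) / n) / 0.5 := rfl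
      have hl3 : (Real.log (Skeleton.P3 D) : ℂ) ≠ 0 := by
        rw [log_P3_eq, ← hLdef]; exact_mod_cast (by positivity : (0.498 : ℝ) * L ^ 9 ≠ 0)
      have hl2 : (Real.log (Skeleton.P2 D) : ℂ) ≠ 0 := by exact_mod_cast (log_P2_pos hℓ3).ne'
      rw [eM, eA, eF]
      field_simp; ring
    rw [hid]
    have h11L : L ^ (1.1 : ℝ) ≤ L ^ 2 := by
      have h : L ^ (1.1 : ℝ) ≤ L ^ (2 : ℝ) := Real.rpow_le_rpow_of_exponent_le hL1 (by norm_num)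
      simpa using h
    have hL15 : (L ^ 15)⁻¹ ≤ (L ^ 14)⁻¹ :=
      inv_anti₀ (by positivity) (pow_le_pow_right₀ hL1 (by norm_num))
    calc ‖conj iota3 * (M₃ n - deriv χ.LFunction 1 / (Real.log (Skeleton.P3 D) : ℂ) *
            frakfW c' D j 6 (Skeleton.P3 D / (n : ℝ))) +
          conj iota4 * (M₂ n - deriv χ.LFunction 1 / (Real.log (Skeleton.P2 D) : ℂ) *
            frakfW c' D j 7 (Skeleton.P2 D / (n : ℝ))) +
          deriv χ.LFunction 1 *
            ((conj iota3 * (Real.log (Skeleton.P3 D) : ℂ)⁻¹ * frakfW c' D j 6 (Skeleton.P3 D / n) +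
                conj iota4 * (Real.log (Skeleton.P2 D) : ℂ)⁻¹ * frakfW c' D j 7 (Skeleton.P2 D / n)) -
              (conj iota3 * frakfW c' D j 6 (bigP D ^ (0.498 : ℝ) / n) / 0.498 +
                conj iota4 * frakfW c' D j 7 (bigP D ^ (0.5 : ℝ) / n) / 0.5) /
                (Real.log (bigP D) : ℂ))‖
        ≤ ‖conj iota3‖ * ‖M₃ n - deriv χ.LFunction 1 / (Real.log (Skeleton.P3 D) : ℂ) *
            frakfW c' D j 6 (Skeleton.P3 D / (n : ℝ))‖ +
          ‖conj iota4‖ * ‖M₂ n - deriv χ.LFunction 1 / (Real.log (Skeleton.P2 D) : ℂ) *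
            frakfW c' D j 7 (Skeleton.P2 D / (n : ℝ))‖ +
          ‖deriv χ.LFunction 1‖ *
            ‖(conj iota3 * (Real.log (Skeleton.P3 D) : ℂ)⁻¹ * frakfW c' D j 6 (Skeleton.P3 D / n) +
                conj iota4 * (Real.log (Skeleton.P2 D) : ℂ)⁻¹ * frakfW c' D j 7 (Skeleton.P2 D / n)) -
              (conj iota3 * frakfW c' D j 6 (bigP D ^ (0.498 : ℝ) / n) / 0.498 +
                conj iota4 * frakfW c' D j 7 (bigP D ^ (0.5 : ℝ) / n) / 0.5) /
                (Real.log (bigP D) : ℂ)‖ := by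
          refine (norm_add_le _ _).trans (add_le_add ((norm_add_le _ _).trans (add_le_add ?_ ?_)) ?_)
          · rw [norm_mul]
          · rw [norm_mul]
          · rw [norm_mul]
      _ ≤ 1.25 * (C₉ * (L ^ 15)⁻¹) + 2.3 * (C₉ * (L ^ 15)⁻¹) +
          (4 * Real.exp (9 / 2) * L ^ 2) * (25000 * L ^ (1.1 : ℝ) * (L ^ 18)⁻¹) := by
          gcongr
      _ ≤ 1.25 * (C₉ * (L ^ 14)⁻¹) + 2.3 * (C₉ * (L ^ 14)⁻¹) +
          (4 * Real.exp (9 / 2) * L ^ 2) * (25000 * L ^ 2 * (L ^ 18)⁻¹) := by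
          gcongr
      _ = m₀ * (L ^ 14)⁻¹ := by rw [hm₀]; field_simp; ring
  -- `‖A(n)‖ ≤ a₀𝓛⁻⁷` for all `n ∈ S`
  have hAn : ∀ n ∈ S, ‖A n‖ ≤ a₀ * (L ^ 7)⁻¹ := by
    intro n hn
    obtain ⟨hn1, hnY⟩ := hSmem n hn
    have hn1R : (1 : ℝ) ≤ n := by exact_mod_cast hn1
    have hF := norm_Fpr_le c' (D := D) hℓ3 hc5 j hn1R (hnY.trans (hYX.trans hX498))
    simp only [hAdef]
    rw [norm_div, norm_mul, Complex.norm_real, Real.norm_of_nonneg hlogP0.le, hlogP]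
    rw [div_le_iff₀ (by positivity)]
    calc ‖deriv χ.LFunction 1‖ * ‖Fpr n‖ ≤ (4 * Real.exp (9 / 2) * L ^ 2) * fpr :=
          mul_le_mul hL' hF (norm_nonneg _) (by positivity)
      _ = a₀ * (L ^ 7)⁻¹ * L ^ 9 := by rw [ha₀]; field_simp
  -- (12.10) on the main `n < Y`
  have hNmain : ∀ n ∈ S, (n : ℝ) < Y → ∀ r ∈ n.divisors, Squarefree r →
      ‖N (n / r) r - c₀ * Pw (n / r) r * G n‖ ≤ C₁₀ * (L ^ 15)⁻¹ := by
    intro n hn hnY r hr _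
    have hn0 := hS0 n hn
    have hrd : r ∣ n := Nat.dvd_of_mem_divisors hr
    have hr0 : r ≠ 0 := Nat.pos_iff_ne_zero.mp (Nat.pos_of_mem_divisors hr)
    have hdr : n / r * r = n := Nat.div_mul_cancel hrd
    have hd1 : 1 ≤ n / r := Nat.div_pos (Nat.le_of_dvd (Nat.pos_of_ne_zero hn0) hrd)
      (Nat.pos_of_ne_zero hr0)
    have hlt : ((n / r * r : ℕ) : ℝ) < P1pp D / bigT D := by rw [hdr]; exact hnY
    have key := h10 (n / r) r hd1 (Nat.one_le_iff_ne_zero.mpr hr0) hlt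
    have e : Sec12B.main1210 c' χ j (n / r) r = c₀ * Pw (n / r) r * G n := by
      simp only [Sec12B.main1210, hc₀def, hPwdef, hGdef]; ring
    simp only [hNdef]
    rw [← e]; exact key
  -- (12.11) at the boundary point
  have hNwin : ∀ n ∈ S, ¬ (n : ℝ) < Y → ∀ r ∈ n.divisors, Squarefree r →
      ‖N (n / r) r‖ ≤ C₁₁ * alpha D * ell D * ((n : ℝ) / Nat.totient n) ^ 2 := by
    intro n hn hnY r hr _
    have hn0 := hS0 n hn
    obtain ⟨-, hnY'⟩ := hSmem n hn
    have hrd : r ∣ n := Nat.dvd_of_mem_divisors hr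
    have hr0 : r ≠ 0 := Nat.pos_iff_ne_zero.mp (Nat.pos_of_mem_divisors hr)
    have hdr : n / r * r = n := Nat.div_mul_cancel hrd
    have hd1 : 1 ≤ n / r := Nat.div_pos (Nat.le_of_dvd (Nat.pos_of_ne_zero hn0) hrd)
      (Nat.pos_of_ne_zero hr0)
    have h1 : P1pp D / bigT D ≤ ((n / r * r : ℕ) : ℝ) := by rw [hdr]; exact not_lt.mp hnY
    have h2 : ((n / r * r : ℕ) : ℝ) ≤ P1pp D := by rw [hdr]; exact hnY'.trans hYP1pp
    have key := h11 (n / r) r hd1 (Nat.one_le_iff_ne_zero.mpr hr0) h1 h2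
    have hratio : 1 ≤ ((n : ℝ) / Nat.totient n) ^ 2 := one_le_pow₀ (one_le_self_div_totient hn0)
    have hpos : 0 ≤ C₁₁ * alpha D * ell D := by positivity
    simp only [hNdef]
    calc ‖Sec12B.sum122 c' χ j (n / r) r‖ ≤ C₁₁ * alpha D * ell D := key
      _ = C₁₁ * alpha D * ell D * 1 := (mul_one _).symm
      _ ≤ C₁₁ * alpha D * ell D * ((n : ℝ) / Nat.totient n) ^ 2 := by gcongr
  -- Step C: the assembly
  have hassembly := range_assembly_bound₂ (S := S) hS0 (fun n : ℕ => (n : ℝ) < Y) a M A G N Pw c₀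
    (eM := m₀ * (L ^ 14)⁻¹) (BM := a₀ * (L ^ 7)⁻¹) (BW := a₀ * (L ^ 7)⁻¹ + m₀ * (L ^ 14)⁻¹)
    (BG := 1) (eN := C₁₀ * (L ^ 15)⁻¹) (eW := C₁₁ * alpha D * ell D)
    (by positivity) (by positivity) (by positivity) hPi
    (fun n hn _ => hMA n hn) hAn
    (fun n hn _ => by
      have h1 := hMA n hn
      have h2 := hAn n hn
      have := norm_le_norm_add_norm_sub' (M n) (A n)
      linarith)
    (fun n _ => by simp [hGdef])
    hNmain hNwin
  -- the weights
  have hW₁ : ∑ n ∈ S.filter (fun n : ℕ => (n : ℝ) < Y), ‖a n‖ * ((n : ℝ) / Nat.totient n) ≤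
      1 + Real.exp 256 * (1 + Real.log Y) := by
    have hsub : ∀ n ∈ S.filter (fun n : ℕ => (n : ℝ) < Y), 1 ≤ n ∧ (n : ℝ) ≤ Y :=
      fun n hn => hSmem n (Finset.mem_filter.mp hn).1
    calc ∑ n ∈ S.filter (fun n : ℕ => (n : ℝ) < Y), ‖a n‖ * ((n : ℝ) / Nat.totient n)
        ≤ ∑ n ∈ S.filter (fun n : ℕ => (n : ℝ) < Y), ‖a n‖ * ((n : ℝ) / Nat.totient n) ^ 3 := by
          refine Finset.sum_le_sum fun n hn => ?_
          have h1 := one_le_self_div_totient (hS0 n (Finset.mem_filter.mp hn).1)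
          have : (n : ℝ) / Nat.totient n ≤ ((n : ℝ) / Nat.totient n) ^ 3 := by
            calc (n : ℝ) / Nat.totient n = ((n : ℝ) / Nat.totient n) ^ 1 := (pow_one _).symm
              _ ≤ ((n : ℝ) / Nat.totient n) ^ 3 := pow_le_pow_right₀ h1 (by norm_num)
          exact mul_le_mul_of_nonneg_left this (norm_nonneg _)
      _ ≤ 1 + Real.exp 256 * (1 + Real.log Y) := sum_weights_main_le c' χ j hY1 hsub
  have hW₂ : ∑ n ∈ S.filter (fun n : ℕ => ¬ (n : ℝ) < Y), ‖a n‖ * ((n : ℝ) / Nat.totient n) ^ 3 ≤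
      Real.exp 256 * (3 + Real.log Y - Real.log Y) := by
    refine sum_weights_le c' χ j hY2 le_rfl fun n hn => ?_
    obtain ⟨hn, hnY⟩ := Finset.mem_filter.mp hn
    exact ⟨not_lt.mp hnY, (hSmem n hn).2⟩
  -- Step D: the printed main term, split at `Y`
  have hmainS : ∑ n ∈ S, a n * ((n : ℂ) / (Nat.totient n : ℂ)) * (A n * c₀ * G n) =
      deriv χ.LFunction 1 ^ 2 * bstar * (betaJ c' D (j + 1) * betaJ c' D (j + 2)) *
        ∑ n ∈ S, (‖χ (n : ZMod D)‖ : ℂ) * lamZero c' D j n / (Nat.totient n : ℂ) * Fpr n := by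
    rw [Finset.mul_sum]
    refine Finset.sum_congr rfl fun n hn => ?_
    have hn0 : (n : ℂ) ≠ 0 := by exact_mod_cast hS0 n hn
    have hφ : (Nat.totient n : ℂ) ≠ 0 := by
      exact_mod_cast (Nat.totient_pos.mpr (Nat.pos_of_ne_zero (hS0 n hn))).ne'
    have hlP : (Real.log (bigP D) : ℂ) ≠ 0 := by exact_mod_cast hlogP0.ne'
    have ea : a n = (‖χ (n : ZMod D)‖ : ℂ) * lamZero c' D j n / (n : ℂ) := rfl
    have eA : A n = deriv χ.LFunction 1 * Fpr n / (Real.log (bigP D) : ℂ) := rfl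
    have eG : G n = 1 := rfl
    rw [ea, eA, eG, hc₀def]
    field_simp
  have hSX : (Finset.Ico 1 ⌈X⌉₊).filter (fun n => rngLow D n) = S := by
    ext n
    simp only [hSdef, Finset.mem_filter, Finset.mem_Ico]
    constructor
    · rintro ⟨⟨h1, h2⟩, h3⟩
      exact ⟨⟨h1, lt_of_lt_of_le h2 hceilX⟩, h3⟩
    · rintro ⟨⟨h1, -⟩, h3⟩
      refine ⟨⟨h1, ?_⟩, h3⟩
      have : (n : ℝ) < X := lt_of_le_of_lt h3 (by linarith)
      exact Nat.lt_ceil.mpr this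
  have hmain_split : main1212sum c' χ j =
      deriv χ.LFunction 1 ^ 2 * bstar * (betaJ c' D (j + 1) * betaJ c' D (j + 2)) *
        ∑ n ∈ S, (‖χ (n : ZMod D)‖ : ℂ) * lamZero c' D j n / (Nat.totient n : ℂ) * Fpr n +
      deriv χ.LFunction 1 ^ 2 * bstar * (betaJ c' D (j + 1) * betaJ c' D (j + 2)) *
        ∑ n ∈ (Finset.Ico 1 ⌈X⌉₊).filter (fun n => ¬ rngLow D n),
          (‖χ (n : ZMod D)‖ : ℂ) * lamZero c' D j n / (Nat.totient n : ℂ) * Fpr n := by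
    rw [main1212sum_eq_sum, ← mul_add, ← hSX, Finset.sum_filter_add_sum_filter_not]
  -- the window `Y < n < X` of the printed main term
  set K₁₂ : ℂ := deriv χ.LFunction 1 ^ 2 * bstar * (betaJ c' D (j + 1) * betaJ c' D (j + 2)) with hK₁₂
  have hK₁₂n : ‖K₁₂‖ ≤ k₀ * (L ^ 14)⁻¹ := by
    have e : ‖K₁₂‖ = ‖deriv χ.LFunction 1‖ * (‖bstar‖ * ‖deriv χ.LFunction 1‖ *
        (‖betaJ c' D (j + 1) * betaJ c' D (j + 2)‖ * Real.log (bigP D))) / Real.log (bigP D) := by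
      rw [hK₁₂, norm_mul, norm_mul, norm_pow]
      field_simp
    have hc₀' : ‖bstar‖ * ‖deriv χ.LFunction 1‖ *
        (‖betaJ c' D (j + 1) * betaJ c' D (j + 2)‖ * Real.log (bigP D)) ≤ c₀₀ * (L ^ 7)⁻¹ := by
      calc ‖bstar‖ * ‖deriv χ.LFunction 1‖ * (‖betaJ c' D (j + 1) * betaJ c' D (j + 2)‖ * Real.log (bigP D))
          ≤ ‖bstar‖ * (4 * Real.exp (9 / 2) * L ^ 2) * (9 * π * (1 + 5 * |c'| * π) ^ 2 * alpha D) := by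
            gcongr
        _ = c₀₀ * (L ^ 7)⁻¹ := by rw [hc₀₀, hαeq, ← hLdef]; field_simp
    rw [e, div_le_iff₀ hlogP0]
    have hc₀'0 : 0 ≤ ‖bstar‖ * ‖deriv χ.LFunction 1‖ *
        (‖betaJ c' D (j + 1) * betaJ c' D (j + 2)‖ * Real.log (bigP D)) :=
      mul_nonneg (mul_nonneg (norm_nonneg _) (norm_nonneg _)) (mul_nonneg (norm_nonneg _) hlogP0.le)
    have h4pos : 0 ≤ 4 * Real.exp (9 / 2) * L ^ 2 := by positivity
    calc ‖deriv χ.LFunction 1‖ * (‖bstar‖ * ‖deriv χ.LFunction 1‖ *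
          (‖betaJ c' D (j + 1) * betaJ c' D (j + 2)‖ * Real.log (bigP D)))
        ≤ (4 * Real.exp (9 / 2) * L ^ 2) * (c₀₀ * (L ^ 7)⁻¹) :=
          mul_le_mul hL' hc₀' hc₀'0 h4pos
      _ = k₀ * (L ^ 14)⁻¹ * L ^ 9 := by rw [hk₀]; field_simp
      _ = k₀ * (L ^ 14)⁻¹ * Real.log (bigP D) := by rw [hlogP]
  have hwindow : ‖∑ n ∈ (Finset.Ico 1 ⌈X⌉₊).filter (fun n => ¬ rngLow D n),
      (‖χ (n : ZMod D)‖ : ℂ) * lamZero c' D j n / (Nat.totient n : ℂ) * Fpr n‖ ≤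
      fpr * (Real.exp 256 * (3 + Real.log X - Real.log Y)) := by
    have hmem : ∀ n ∈ (Finset.Ico 1 ⌈X⌉₊).filter (fun n => ¬ rngLow D n),
        1 ≤ n ∧ Y ≤ (n : ℝ) ∧ (n : ℝ) ≤ X := by
      intro n hn
      rw [Finset.mem_filter, Finset.mem_Ico] at hn
      refine ⟨hn.1.1, le_of_lt (not_le.mp hn.2), le_of_lt (Nat.lt_ceil.mp hn.1.2)⟩
    calc ‖∑ n ∈ (Finset.Ico 1 ⌈X⌉₊).filter (fun n => ¬ rngLow D n),
          (‖χ (n : ZMod D)‖ : ℂ) * lamZero c' D j n / (Nat.totient n : ℂ) * Fpr n‖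
        ≤ ∑ n ∈ (Finset.Ico 1 ⌈X⌉₊).filter (fun n => ¬ rngLow D n),
          ‖(‖χ (n : ZMod D)‖ : ℂ) * lamZero c' D j n / (Nat.totient n : ℂ) * Fpr n‖ := norm_sum_le _ _
      _ ≤ ∑ n ∈ (Finset.Ico 1 ⌈X⌉₊).filter (fun n => ¬ rngLow D n),
          ‖a n‖ * ((n : ℝ) / Nat.totient n) ^ 3 * fpr := by
          refine Finset.sum_le_sum fun n hn => ?_
          obtain ⟨hn1, hnY, hnX⟩ := hmem n hn
          have hn0 : n ≠ 0 := by omega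
          have hn0R : (n : ℝ) ≠ 0 := by exact_mod_cast hn0
          have hφ0 : (0 : ℝ) < Nat.totient n := by exact_mod_cast Nat.totient_pos.mpr (by omega)
          have hF := norm_Fpr_le c' (D := D) hℓ3 hc5 j (by exact_mod_cast hn1) (hnX.trans hX498)
          have hrat1 := one_le_self_div_totient hn0
          have e : ‖(‖χ (n : ZMod D)‖ : ℂ) * lamZero c' D j n / (Nat.totient n : ℂ) * Fpr n‖ =
              ‖a n‖ * ((n : ℝ) / Nat.totient n) * ‖Fpr n‖ := by
            simp only [hadef]
            rw [norm_mul, norm_div, norm_div, norm_mul, Complex.norm_natCast, Complex.norm_natCast]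
            field_simp
          rw [e]
          have h3 : (n : ℝ) / Nat.totient n ≤ ((n : ℝ) / Nat.totient n) ^ 3 := by
            calc (n : ℝ) / Nat.totient n = ((n : ℝ) / Nat.totient n) ^ 1 := (pow_one _).symm
              _ ≤ ((n : ℝ) / Nat.totient n) ^ 3 := pow_le_pow_right₀ hrat1 (by norm_num)
          gcongr
      _ = (∑ n ∈ (Finset.Ico 1 ⌈X⌉₊).filter (fun n => ¬ rngLow D n),
          ‖a n‖ * ((n : ℝ) / Nat.totient n) ^ 3) * fpr := by rw [Finset.sum_mul]
      _ ≤ (Real.exp 256 * (3 + Real.log X - Real.log Y)) * fpr := by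
          gcongr
          exact sum_weights_le c' χ j hY2 hYX fun n hn => (hmem n hn).2
      _ = fpr * (Real.exp 256 * (3 + Real.log X - Real.log Y)) := by ring
  -- logarithms of the scales
  have hlogY : Real.log Y ≤ L ^ 9 := by
    rw [← hlogP]
    exact Real.log_le_log hY0 (hYP1pp.trans hP1ppP)
  have hlogY0 : 0 ≤ Real.log Y := Real.log_nonneg hY1
  have hlogXY : Real.log X - Real.log Y ≤ L ^ 2 := by
    -- `X/Y = T/(Dt₀) ≤ T`, `log T = 𝓛^{1.1} ≤ 𝓛²`
    have hDt1 := Dt0_ge_one (D := D) hℓ3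
    have hDt0 := Dt0_pos (D := D) hℓ3
    have hXY : X / Y = bigT D / ((D : ℝ) * t0 D) := by
      rw [hXdef, hYdef, P1pp]
      field_simp
    have hXYT : X / Y ≤ bigT D := by
      rw [hXY]; exact div_le_self hT0.le hDt1
    have h11 : L ^ (1.1 : ℝ) ≤ L ^ 2 := by
      have h : L ^ (1.1 : ℝ) ≤ L ^ (2 : ℝ) := Real.rpow_le_rpow_of_exponent_le hL1 (by norm_num)
      simpa using h
    calc Real.log X - Real.log Y = Real.log (X / Y) := (Real.log_div (by linarith) hY0.ne').symm
      _ ≤ Real.log (bigT D) := Real.log_le_log (by positivity) hXYT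
      _ = L ^ (1.1 : ℝ) := by rw [bigT, Real.log_exp]
      _ ≤ L ^ 2 := h11
  -- Step E: combine
  have hdiff : SjOn c' D j (a12 χ) a25 (rngLow D) - main1212sum c' χ j =
      ((∑ n ∈ S, ∑ r ∈ n.divisors,
          (if Squarefree r then a n / (Nat.totient r : ℂ) * M n * N (n / r) r else 0)) -
        ∑ n ∈ S, a n * ((n : ℂ) / (Nat.totient n : ℂ)) * (A n * c₀ * G n)) -
      K₁₂ * ∑ n ∈ (Finset.Ico 1 ⌈X⌉₊).filter (fun n => ¬ rngLow D n),
          (‖χ (n : ZMod D)‖ : ℂ) * lamZero c' D j n / (Nat.totient n : ℂ) * Fpr n := by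
    rw [hSj, hmainS, hmain_split]; ring
  rw [hdiff]
  refine (norm_sub_le _ _).trans ?_
  rw [norm_mul]
  -- currency: `w k = (L^k)⁻¹`
  have hw_le : ∀ {a b : ℕ}, a ≤ b → (L ^ b)⁻¹ ≤ (L ^ a)⁻¹ := fun hab =>
    inv_anti₀ (by positivity) (pow_le_pow_right₀ hL1 hab)
  have hw_mul : ∀ a b : ℕ, (L ^ a)⁻¹ * (L ^ b)⁻¹ = (L ^ (a + b))⁻¹ := fun a b => by
    rw [← mul_inv, ← pow_add]
  have hLw : ∀ a b : ℕ, L ^ a * (L ^ (a + b))⁻¹ = (L ^ b)⁻¹ := fun a b => by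
    rw [pow_add, mul_inv, ← mul_assoc, mul_inv_cancel₀ (by positivity), one_mul]
  have e256 : (1 : ℝ) ≤ Real.exp 256 := Real.one_le_exp (by norm_num)
  have hL9 : (1 : ℝ) ≤ L ^ 9 := one_le_pow₀ hL1
  have hL2 : (1 : ℝ) ≤ L ^ 2 := one_le_pow₀ hL1
  -- T1
  have hT1 : (1 + Real.exp 256 * (1 + Real.log Y)) *
      ((a₀ * (L ^ 7)⁻¹ + m₀ * (L ^ 14)⁻¹) * (C₁₀ * (L ^ 15)⁻¹) +
        m₀ * (L ^ 14)⁻¹ * ‖c₀‖ * 1) ≤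
      3 * Real.exp 256 * ((a₀ + m₀) * C₁₀ + m₀ * c₀₀) * (L ^ 12)⁻¹ := by
    have hWle : 1 + Real.exp 256 * (1 + Real.log Y) ≤ 3 * Real.exp 256 * L ^ 9 := by
      have : Real.exp 256 * Real.log Y ≤ Real.exp 256 * L ^ 9 := by gcongr
      nlinarith
    have hF1pos : 0 ≤ (a₀ * (L ^ 7)⁻¹ + m₀ * (L ^ 14)⁻¹) * (C₁₀ * (L ^ 15)⁻¹) +
        m₀ * (L ^ 14)⁻¹ * ‖c₀‖ * 1 := by
      have : 0 ≤ (L ^ 7)⁻¹ := by positivity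
      have : 0 ≤ (L ^ 14)⁻¹ := by positivity
      have : 0 ≤ (L ^ 15)⁻¹ := by positivity
      positivity
    have hin : (a₀ * (L ^ 7)⁻¹ + m₀ * (L ^ 14)⁻¹) * (C₁₀ * (L ^ 15)⁻¹) +
        m₀ * (L ^ 14)⁻¹ * ‖c₀‖ * 1 ≤ ((a₀ + m₀) * C₁₀ + m₀ * c₀₀) * (L ^ 21)⁻¹ := by
      have hw7 : 0 ≤ (L ^ 7)⁻¹ := by positivity
      have hw14 : 0 ≤ (L ^ 14)⁻¹ := by positivity
      have i1 : a₀ * (L ^ 7)⁻¹ + m₀ * (L ^ 14)⁻¹ ≤ a₀ * (L ^ 7)⁻¹ + m₀ * (L ^ 7)⁻¹ :=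
        add_le_add le_rfl (mul_le_mul_of_nonneg_left (hw_le (by norm_num : 7 ≤ 14)) hm₀0)
      have i2 : C₁₀ * (L ^ 15)⁻¹ ≤ C₁₀ * (L ^ 14)⁻¹ :=
        mul_le_mul_of_nonneg_left (hw_le (by norm_num : 14 ≤ 15)) hC₁₀
      have i3 : m₀ * (L ^ 14)⁻¹ * ‖c₀‖ * 1 ≤ m₀ * (L ^ 14)⁻¹ * (c₀₀ * (L ^ 7)⁻¹) * 1 := by
        rw [mul_one, mul_one]
        exact mul_le_mul_of_nonneg_left hc₀ (mul_nonneg hm₀0 hw14)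
      have i12 : (a₀ * (L ^ 7)⁻¹ + m₀ * (L ^ 14)⁻¹) * (C₁₀ * (L ^ 15)⁻¹) ≤
          (a₀ * (L ^ 7)⁻¹ + m₀ * (L ^ 7)⁻¹) * (C₁₀ * (L ^ 14)⁻¹) :=
        mul_le_mul i1 i2 (by positivity) (by positivity)
      calc (a₀ * (L ^ 7)⁻¹ + m₀ * (L ^ 14)⁻¹) * (C₁₀ * (L ^ 15)⁻¹) + m₀ * (L ^ 14)⁻¹ * ‖c₀‖ * 1
          ≤ (a₀ * (L ^ 7)⁻¹ + m₀ * (L ^ 7)⁻¹) * (C₁₀ * (L ^ 14)⁻¹) +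
              m₀ * (L ^ 14)⁻¹ * (c₀₀ * (L ^ 7)⁻¹) * 1 := add_le_add i12 i3
        _ = ((a₀ + m₀) * C₁₀ + m₀ * c₀₀) * ((L ^ 7)⁻¹ * (L ^ 14)⁻¹) := by ring
        _ = ((a₀ + m₀) * C₁₀ + m₀ * c₀₀) * (L ^ 21)⁻¹ := by rw [hw_mul]
    calc (1 + Real.exp 256 * (1 + Real.log Y)) *
          ((a₀ * (L ^ 7)⁻¹ + m₀ * (L ^ 14)⁻¹) * (C₁₀ * (L ^ 15)⁻¹) + m₀ * (L ^ 14)⁻¹ * ‖c₀‖ * 1)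
        ≤ (3 * Real.exp 256 * L ^ 9) * (((a₀ + m₀) * C₁₀ + m₀ * c₀₀) * (L ^ 21)⁻¹) :=
          mul_le_mul hWle hin hF1pos (by positivity)
      _ = 3 * Real.exp 256 * ((a₀ + m₀) * C₁₀ + m₀ * c₀₀) * (L ^ 9 * (L ^ (9 + 12))⁻¹) := by
          norm_num; ring
      _ = 3 * Real.exp 256 * ((a₀ + m₀) * C₁₀ + m₀ * c₀₀) * (L ^ 12)⁻¹ := by rw [hLw]
  -- T2
  have hT2 : Real.exp 256 * (3 + Real.log Y - Real.log Y) *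
      ((a₀ * (L ^ 7)⁻¹ + m₀ * (L ^ 14)⁻¹) * (C₁₁ * alpha D * ell D) +
        a₀ * (L ^ 7)⁻¹ * ‖c₀‖ * 1) ≤
      3 * Real.exp 256 * ((a₀ + m₀) * (C₁₁ * π) + a₀ * c₀₀) * (L ^ 12)⁻¹ := by
    have hαℓ' : alpha D * ell D = π * (L ^ 8)⁻¹ := by
      rw [hαeq, ← hLdef]; field_simp
    have eC : C₁₁ * alpha D * ell D = C₁₁ * (π * (L ^ 8)⁻¹) := by rw [mul_assoc, hαℓ']
    have hin : (a₀ * (L ^ 7)⁻¹ + m₀ * (L ^ 14)⁻¹) * (C₁₁ * alpha D * ell D) +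
        a₀ * (L ^ 7)⁻¹ * ‖c₀‖ * 1 ≤ ((a₀ + m₀) * (C₁₁ * π) + a₀ * c₀₀) * (L ^ 14)⁻¹ := by
      rw [eC]
      have hw7 : 0 ≤ (L ^ 7)⁻¹ := by positivity
      have i1 : a₀ * (L ^ 7)⁻¹ + m₀ * (L ^ 14)⁻¹ ≤ a₀ * (L ^ 7)⁻¹ + m₀ * (L ^ 7)⁻¹ :=
        add_le_add le_rfl (mul_le_mul_of_nonneg_left (hw_le (by norm_num : 7 ≤ 14)) hm₀0)
      have i2 : C₁₁ * (π * (L ^ 8)⁻¹) ≤ C₁₁ * (π * (L ^ 7)⁻¹) :=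
        mul_le_mul_of_nonneg_left (mul_le_mul_of_nonneg_left (hw_le (by norm_num : 7 ≤ 8))
          Real.pi_pos.le) hC₁₁
      have i3 : a₀ * (L ^ 7)⁻¹ * ‖c₀‖ * 1 ≤ a₀ * (L ^ 7)⁻¹ * (c₀₀ * (L ^ 7)⁻¹) * 1 := by
        rw [mul_one, mul_one]
        exact mul_le_mul_of_nonneg_left hc₀ (mul_nonneg ha₀0 hw7)
      have i12 : (a₀ * (L ^ 7)⁻¹ + m₀ * (L ^ 14)⁻¹) * (C₁₁ * (π * (L ^ 8)⁻¹)) ≤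
          (a₀ * (L ^ 7)⁻¹ + m₀ * (L ^ 7)⁻¹) * (C₁₁ * (π * (L ^ 7)⁻¹)) :=
        mul_le_mul i1 i2 (by positivity) (by positivity)
      calc (a₀ * (L ^ 7)⁻¹ + m₀ * (L ^ 14)⁻¹) * (C₁₁ * (π * (L ^ 8)⁻¹)) + a₀ * (L ^ 7)⁻¹ * ‖c₀‖ * 1
          ≤ (a₀ * (L ^ 7)⁻¹ + m₀ * (L ^ 7)⁻¹) * (C₁₁ * (π * (L ^ 7)⁻¹)) +
              a₀ * (L ^ 7)⁻¹ * (c₀₀ * (L ^ 7)⁻¹) * 1 := add_le_add i12 i3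
        _ = ((a₀ + m₀) * (C₁₁ * π) + a₀ * c₀₀) * ((L ^ 7)⁻¹ * (L ^ 7)⁻¹) := by ring
        _ = ((a₀ + m₀) * (C₁₁ * π) + a₀ * c₀₀) * (L ^ 14)⁻¹ := by rw [hw_mul]
    have h3 : Real.exp 256 * (3 + Real.log Y - Real.log Y) ≤ 3 * Real.exp 256 := le_of_eq (by ring)
    have hF2pos : 0 ≤ (a₀ * (L ^ 7)⁻¹ + m₀ * (L ^ 14)⁻¹) * (C₁₁ * alpha D * ell D) +
        a₀ * (L ^ 7)⁻¹ * ‖c₀‖ * 1 := by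
      rw [eC]
      have : 0 ≤ (L ^ 7)⁻¹ := by positivity
      have : 0 ≤ (L ^ 14)⁻¹ := by positivity
      have : 0 ≤ (L ^ 8)⁻¹ := by positivity
      positivity
    have h3pos : 0 ≤ 3 * Real.exp 256 := by positivity
    calc Real.exp 256 * (3 + Real.log Y - Real.log Y) *
          ((a₀ * (L ^ 7)⁻¹ + m₀ * (L ^ 14)⁻¹) * (C₁₁ * alpha D * ell D) + a₀ * (L ^ 7)⁻¹ * ‖c₀‖ * 1)
        ≤ (3 * Real.exp 256) * (((a₀ + m₀) * (C₁₁ * π) + a₀ * c₀₀) * (L ^ 14)⁻¹) :=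
          mul_le_mul h3 hin hF2pos h3pos
      _ ≤ (3 * Real.exp 256) * (((a₀ + m₀) * (C₁₁ * π) + a₀ * c₀₀) * (L ^ 12)⁻¹) := by
          have h1412 : (L ^ 14)⁻¹ ≤ (L ^ 12)⁻¹ := hw_le (by norm_num)
          have hB : 0 ≤ (a₀ + m₀) * (C₁₁ * π) + a₀ * c₀₀ := by positivity
          exact mul_le_mul_of_nonneg_left (mul_le_mul_of_nonneg_left h1412 hB) h3pos
      _ = 3 * Real.exp 256 * ((a₀ + m₀) * (C₁₁ * π) + a₀ * c₀₀) * (L ^ 12)⁻¹ := by ring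
  -- T3
  have hT3 : ‖K₁₂‖ * ‖∑ n ∈ (Finset.Ico 1 ⌈X⌉₊).filter (fun n => ¬ rngLow D n),
      (‖χ (n : ZMod D)‖ : ℂ) * lamZero c' D j n / (Nat.totient n : ℂ) * Fpr n‖ ≤
      4 * Real.exp 256 * k₀ * fpr * (L ^ 12)⁻¹ := by
    have hk14 : 0 ≤ k₀ * (L ^ 14)⁻¹ := mul_nonneg hk₀0 (inv_nonneg.mpr (pow_nonneg hL0.le 14))
    have hlXY : Real.log Y ≤ Real.log X := Real.log_le_log hY0 hYX
    have hlog4 : 3 + Real.log X - Real.log Y ≤ 4 * L ^ 2 := by linarith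
    calc ‖K₁₂‖ * ‖∑ n ∈ (Finset.Ico 1 ⌈X⌉₊).filter (fun n => ¬ rngLow D n),
          (‖χ (n : ZMod D)‖ : ℂ) * lamZero c' D j n / (Nat.totient n : ℂ) * Fpr n‖
        ≤ ‖K₁₂‖ * (fpr * (Real.exp 256 * (3 + Real.log X - Real.log Y))) :=
          mul_le_mul_of_nonneg_left hwindow (norm_nonneg K₁₂)
      _ ≤ (k₀ * (L ^ 14)⁻¹) * (fpr * (Real.exp 256 * (3 + Real.log X - Real.log Y))) := by
          refine mul_le_mul_of_nonneg_right hK₁₂n ?_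
          have : 0 ≤ 3 + Real.log X - Real.log Y := by linarith
          positivity
      _ ≤ (k₀ * (L ^ 14)⁻¹) * (fpr * (Real.exp 256 * (4 * L ^ 2))) := by
          refine mul_le_mul_of_nonneg_left ?_ hk14
          exact mul_le_mul_of_nonneg_left (mul_le_mul_of_nonneg_left hlog4 (by positivity)) hfpr0
      _ = 4 * Real.exp 256 * k₀ * fpr * (L ^ 2 * (L ^ (2 + 12))⁻¹) := by norm_num; ring
      _ = 4 * Real.exp 256 * k₀ * fpr * (L ^ 12)⁻¹ := by rw [hLw]
  have hF1 : 0 ≤ (a₀ * (L ^ 7)⁻¹ + m₀ * (L ^ 14)⁻¹) * (C₁₀ * (L ^ 15)⁻¹) +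
      m₀ * (L ^ 14)⁻¹ * ‖c₀‖ * 1 := by
    have : 0 ≤ (L ^ 7)⁻¹ := by positivity
    have : 0 ≤ (L ^ 14)⁻¹ := by positivity
    have : 0 ≤ (L ^ 15)⁻¹ := by positivity
    positivity
  have hF2 : 0 ≤ (a₀ * (L ^ 7)⁻¹ + m₀ * (L ^ 14)⁻¹) * (C₁₁ * alpha D * ell D) +
      a₀ * (L ^ 7)⁻¹ * ‖c₀‖ * 1 := by
    have : 0 ≤ (L ^ 7)⁻¹ := by positivity
    have : 0 ≤ (L ^ 14)⁻¹ := by positivity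
    have : 0 ≤ ell D := hL0.le
    positivity
  have step := hassembly.trans (add_le_add ((mul_le_mul_of_nonneg_right hW₁ hF1).trans hT1)
    ((mul_le_mul_of_nonneg_right hW₂ hF2).trans hT2))
  have hsum := add_le_add step hT3
  refine hsum.trans (le_of_eq ?_)
  rw [hK]; ring

/-! ## The edge: (12.12) from Lemma 8.2 and Lemma 12.2 -/

/-- **(12.12), first equality, from Lemma 8.2 and Lemma 12.2** (the printed "By Lemma 8.2, 8.3 and 12.2"):
for every `ε > 0` and all large `D` (under (A), for `𝐚₂₅ = conj(χϰ₁₃)`, `j ∈ {1,2,3}`),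
`‖S_j(𝐚₁₂,𝐚₂₅)|_{dr≤P″₁/T} − L′(1,χ)²b*β_{j+1}β_{j+2}Σ_{n<P^{0.496}}|χ(n)|λ₀ⱼ(n)φ(n)⁻¹(…)‖ ≤ εα`, given
Lemma 8.2 (`Skeleton.Lemma82 c′`, a tree theorem for `c′ ≥ 0`) and Lemma 12.2 as typed
(`Sec12B.Lemma122 c′ (𝓛⁻¹⁵) = Eq1210L15 ∧ Eq1211`). [cite: Zhang2022LandauSiegel, §12 (12.12) p.71, tex L3605–L3612] -/
theorem eq1212_first_of_lemma122 (h82 : Lemma82 c')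
    (h122 : Sec12B.Lemma122 c' (fun D => (ell D ^ 15)⁻¹)) :
    ∀ ε : ℝ, 0 < ε → ForAllLarge fun D _ χ => AssumptionA D χ →
      ∀ a25 : ℕ → ℂ, (∀ n, a25 n = conj (χ (n : ZMod D) * vk13 D n)) →
        ∀ j ∈ ({1, 2, 3} : Finset ℕ),
          ‖SjOn c' D j (a12 χ) a25 (rngLow D) - main1212sum c' χ j‖ ≤ ε * alpha D := by
  intro ε hε
  obtain ⟨C₉a, h9⟩ := Section9Discharge.step9u002_sharp c' h82
  obtain ⟨C₉b, h8⟩ := Section9Discharge.step8u041_of_lemma82 c' h82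
  obtain ⟨C₁₀, h10⟩ := h122.1
  obtain ⟨C₁₁, h11⟩ := h122.2
  obtain ⟨K, hK0, hcore⟩ := eq1212_first_core c' (C₉ := max (max C₉a C₉b) 0) (C₁₀ := max C₁₀ 0)
    (C₁₁ := max C₁₁ 0) (le_max_right _ _) (le_max_right _ _) (le_max_right _ _)
  obtain ⟨D₁, hD₁⟩ := Sec14.Eq143.four_D_t0_sq_le_bigT
  obtain ⟨D₂, hD₂⟩ := exists_nat_forall_le_ell (K / (ε * π) + 5)
  have hbig : ForAllLarge fun D _ _ => 4 * (D : ℝ) * t0 D ^ 2 ≤ bigT D ∧ K / (ε * π) + 5 ≤ ell D :=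
    ⟨max D₁ D₂, fun D _ _ hD _ _ =>
      ⟨hD₁ D (le_trans (le_max_left _ _) hD), hD₂ D (le_trans (le_max_right _ _) hD)⟩⟩
  refine ((((h9.and h8).and (h10.and h11)).and (Sec10C.forAllLarge_five_c c')).and hbig).mono ?_
  intro D _ χ hq hp hh hA a25 ha25 j hj
  obtain ⟨⟨⟨⟨H9, H8⟩, ⟨H10, H11⟩⟩, ⟨-, hℓ6, hc5⟩⟩, ⟨hT4, hℓK⟩⟩ := hh
  have hℓ5 : 5 ≤ ell D := by linarith
  have hL1 : 1 ≤ ell D := by linarith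
  have hL0 : 0 < ell D := by linarith
  have hi15 : 0 ≤ (ell D ^ 15)⁻¹ := by positivity
  have H9' : ∀ d r : ℕ, 1 ≤ d → 1 ≤ r → ((d * r : ℕ) : ℝ) < Skeleton.P3 D / bigT D →
      ‖(∑ m ∈ Finset.Ico 1 (Nsupp D),
            χ (m : ZMod D) * vk3 D (d * r * m) / (m : ℂ) ^ (1 - betaJ c' D j)) -
          deriv χ.LFunction 1 / (Real.log (Skeleton.P3 D) : ℂ) *
            frakfW c' D j 6 (Skeleton.P3 D / ((d * r : ℕ) : ℝ))‖ ≤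
        max (max C₉a C₉b) 0 * (ell D ^ 15)⁻¹ := fun d r hd hr h =>
    (H9 hA j hj d r hd hr h).trans (mul_le_mul_of_nonneg_right
      ((le_max_left _ _).trans (le_max_left _ _)) hi15)
  have H8' : ∀ d r : ℕ, 1 ≤ d → 1 ≤ r → ((d * r : ℕ) : ℝ) < Skeleton.P2 D / bigT D →
      ‖(∑ m ∈ Finset.Ico 1 (Nsupp D),
            χ (m : ZMod D) * vk2 D (d * r * m) / (m : ℂ) ^ (1 - betaJ c' D j)) -
          deriv χ.LFunction 1 / (Real.log (Skeleton.P2 D) : ℂ) *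
            frakfW c' D j 7 (Skeleton.P2 D / ((d * r : ℕ) : ℝ))‖ ≤
        max (max C₉a C₉b) 0 * (ell D ^ 15)⁻¹ := fun d r hd hr h =>
    (H8 hA j hj d r hd hr h).trans (mul_le_mul_of_nonneg_right
      ((le_max_right _ _).trans (le_max_left _ _)) hi15)
  have H10' : ∀ d r : ℕ, 1 ≤ d → 1 ≤ r → ((d * r : ℕ) : ℝ) < P1pp D / bigT D →
      ‖Sec12B.sum122 c' χ j d r - Sec12B.main1210 c' χ j d r‖ ≤ max C₁₀ 0 * (ell D ^ 15)⁻¹ :=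
    fun d r hd hr h => (H10 hA j hj d r hd hr h).trans
      (mul_le_mul_of_nonneg_right (le_max_left _ _) hi15)
  have H11' : ∀ d r : ℕ, 1 ≤ d → 1 ≤ r → P1pp D / bigT D ≤ ((d * r : ℕ) : ℝ) →
      ((d * r : ℕ) : ℝ) ≤ P1pp D → ‖Sec12B.sum122 c' χ j d r‖ ≤ max C₁₁ 0 * alpha D * ell D := by
    intro d r hd hr h1 h2
    have hα : 0 ≤ alpha D := (alpha_facts (D := D) (by linarith)).1.le
    refine (H11 hA j hj d r hd hr h1 h2).trans ?_
    have : C₁₁ * alpha D * ell D = C₁₁ * (alpha D * ell D) := by ring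
    rw [this, mul_assoc (max C₁₁ 0)]
    exact mul_le_mul_of_nonneg_right (le_max_left _ _) (by positivity)
  have key := hcore hq hp hℓ5 hc5 hT4 j H9' H8' H10' H11' a25 ha25
  -- `K𝓛⁻¹² ≤ εα`
  obtain ⟨hαpos, hαeq, -⟩ := alpha_facts (D := D) (by linarith)
  have hKle : K ≤ ε * π * ell D := by
    have h1 : K / (ε * π) ≤ ell D := by linarith
    have := (div_le_iff₀ (by positivity)).mp h1
    linarith
  refine key.trans ?_
  rw [hαeq]
  calc K * (ell D ^ 12)⁻¹ ≤ ε * π * ell D * (ell D ^ 12)⁻¹ :=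
        mul_le_mul_of_nonneg_right hKle (by positivity)
    _ = ε * (π / ell D ^ 9) * (ell D ^ 2)⁻¹ := by field_simp
    _ ≤ ε * (π / ell D ^ 9) * 1 :=
        mul_le_mul_of_nonneg_left (inv_le_one_of_one_le₀ (one_le_pow₀ hL1)) (by positivity)
    _ = ε * (π / ell D ^ 9) := mul_one _

/-- **The leaf `Typed.Sec12C.Eq1212 c′` ((12.12), both equalities) from Lemma 8.2 and Lemma 12.2**:
`Lemma82 c′ → Sec12B.Lemma122 c′ (𝓛⁻¹⁵) → Eq1212 c′` (first equality: `eq1212_first_of_lemma122`; second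
equality: `eq1212_sum_sub_int`, `Section12Eq1212Integral`). In `theorem1_of_leaves_v19`, `h82 : Lemma82 c′`
is a tree theorem (`lemma82_holds hc′`); Lemma 12.2 = (12.10) [error term blank in print, rate `𝓛⁻¹⁵` =
what its printed proof supports, GAP row G-L3t5-1] ∧ (12.11) [no printed proof, G-L3t5-2].
[cite: Zhang2022LandauSiegel, §12 (12.12) p.71, Lemma 12.2 p.69] -/
theorem eq1212_of_lemma122 (h82 : Lemma82 c') (h122 : Sec12B.Lemma122 c' (fun D => (ell D ^ 15)⁻¹)) :
    Eq1212 c' :=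
  eq1212_of_first_equality c' (eq1212_first_of_lemma122 c' h82 h122)

/-- **The leaf `Typed.Sec12C.Eq1212 c′` from Lemma 12.2 alone, for `c′ ≥ 0`** (Lemma 8.2 is a theorem
of the tree, `Skeleton.lemma82_holds`): `0 ≤ c′ → Sec12B.Lemma122 c′ (𝓛⁻¹⁵) → Eq1212 c′` — the closer
shape for the skeleton pen (`hc′ : 0 ≤ c′` is in scope in `theorem1_of_leaves_v19`).
[cite: Zhang2022LandauSiegel, §12 (12.12) p.71, Lemma 12.2 p.69] -/
theorem eq1212_of_lemma122' {c' : ℝ} (hc' : 0 ≤ c')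
    (h122 : Sec12B.Lemma122 c' (fun D => (ell D ^ 15)⁻¹)) : Eq1212 c' :=
  eq1212_of_lemma122 c' (lemma82_holds hc') h122

end Core

end Literature.NumberTheory.LFunctions.Zhang2022.Typed.Sec12C
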